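import Summits.FinalStateConjecture.FinalStateConjecture.Theorems.EIHFluxBalanceInertialRecessionRechartCausalKit
import Summits.FinalStateConjecture.FinalStateConjecture.Statement
import Summits.FinalStateConjecture.FinalStateConjecture.Theorems.EIHFluxBalanceInertialRecessionGrowingRadius

/-!
# Route EIHFluxBalance — `InertialRecession`, re-charting: assembling the re-charted
# `FinalStateDecomposition` for general spins and motions WITH THE RE-TYPED SUMMIT CLAUSES
# (honest radii `HasExhaustiveCharts`, `IsFutureOriented`)

Helper file for the crux `stmt-FinalStateConjecture-10166`
(`Summit.FinalStateConjecture.FinalStateConjecture.Theses.EIHFluxBalance.InertialRecession`),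
stub `stub_rechart` of line `sublinear-is-free-clean-window-charges` (skeleton r11).

The summit re-typing of 2026-08-16 (semantic-vacuity audit, §2.1 (B)) strengthened
`Summit.FinalStateConjecture.HasExhaustiveCharts` (the near-zone radii must GROW, `Rᵢ(τ) → ∞`, and
be HONEST, `max (r₊(Mᵢ, aᵢ)) 0 + 1 ≤ Rᵢ(τ)`) and added `Summit.FinalStateConjecture.IsFutureOriented`
(orthochronous motions; the push-forwards of the boosted backgrounds' future timelike fields
`Λᵢ V_{Mᵢ,aᵢ}` and of `∂₀` on the flat slabs are eventually future-directed) to the summit's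
conclusion. `exists_finalStateDecomposition_oriented_of_rechart` is the all-spin, all-motion core
assembler (cf. `exists_finalStateDecomposition_of_rechart`, …RechartAssemblyCore, and
`exists_finalStateDecomposition_of_rechart_spin`, …RechartAssemblyCoreSpin) whose conclusion carries
BOTH re-typed clauses: given, on a Cauchy development `𝒟`, the lab chart `Φ : U → 𝒟` with its
exterior region `O = J⁺(ι X) ∩ I⁻(Φ(E))`, hole charts `ψᵢ` on the boosted Kerr exteriors
`boostedKerrExterior Λᵢ cᵢ Mᵢ aᵢ` (smooth open embeddings into `Φ(E)`, near-zone `C²` convergence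
for every fixed radius and along honest growing radii `Rcᵢ`, eventual pairwise disjointness,
orthochronous `Λᵢ`, and eventual future-directedness of `dψᵢ(Λᵢ V_{Mᵢ,aᵢ})` on every truncated
slab), a flat domain `U₀ ⊆ U` with its package (including eventual future-directedness of `dΦ e₀` on
the flat slabs) and the TRANSFER statement, it assembles `d : FinalStateDecomposition 𝒟 O′ 2` with
`O′ := exteriorOf 𝒟 d.charted`, sub-extremal holes, `HasExhaustiveCharts d` and `IsFutureOriented d`.
Pure bookkeeping: the charted region is open (open embeddings, continuity of the rest-frame
time), so `charted′ ⊆ I⁻(charted′)`; `O′ ⊆ O` transports the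
transfer. `exists_finalStateDecomposition_oriented_of_rechart'` is the same with OLD-STYLE radii
hypotheses (convergence along `Rcᵢ` and the transfer for `Rcᵢ`, no growth and no honest lower
bound): the honest growing radii are `max (max (Rcᵢ τ) (Rgᵢ τ)) (r₊ᵢ + 1)` with `Rgᵢ → ∞` the
diagonal radii of the fixed-radius convergence (`exists_growing_radius'`); the truncated deviation
at a `max` of radii is at most the sum, and the certified sets and `J⁻` are monotone in the radii.
[folklore]
-/

noncomputable section

set_option linter.dupNamespace false

open scoped Topology ContDiff Manifold ENNReal
open Filter Set Topology Function TopologicalSpace Literature.Geometry.Lorentzian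

namespace Summit.FinalStateConjecture.FinalStateConjecture.Theorems

section Core

variable {X : Type} [TopologicalSpace X] [ChartedSpace E3 X] [IsManifold (𝓡 3) ∞ X]
  [ConnectedSpace X] {D : InitialDataSet (𝓡 3) X}

-- long bookkeeping proof
set_option maxHeartbeats 800000 in
/-- **Assembly of the re-charted decomposition with the re-typed summit clauses (core).** See the
module docstring. [folklore] -/
theorem exists_finalStateDecomposition_oriented_of_rechart (𝒟 : VacuumCauchyDevelopment D) {N : ℕ}
    (M a : Fin N → ℝ) (hsub : ∀ i, Kerr.IsSubextremal (M i) (a i))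
    (mot : Fin N → lorentzGroup × E4)
    (U : Opens E4) (Φ : U → 𝒟.carrier) (hΦ : ContMDiff 𝓘(ℝ, E4) (𝓡 4) ∞ Φ)
    (O : Set 𝒟.carrier) (Pext : U → Prop) {τ₀ τ₀' : ℝ} (hτ : τ₀ < τ₀')
    (hO : O = 𝒟.metric.causalFuture 𝒟.timeOrientation (range 𝒟.embed) ∩
      𝒟.metric.chronologicalPast 𝒟.timeOrientation (Φ '' {x : U | τ₀ < x.1 0 ∧ Pext x}))
    (himO : Φ '' {x : U | τ₀ < x.1 0 ∧ Pext x} ⊆ O)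
    -- the hole charts
    (ψ : ∀ i, (boostedKerrBackground (mot i).1 (mot i).2 (M i) (a i)).domain → 𝒟.carrier)
    (hψs : ∀ i, ContMDiff 𝓘(ℝ, E4) (𝓡 4) ∞ (ψ i))
    (hψemb : ∀ i, IsOpenEmbedding (ψ i))
    (hψE : ∀ i, range (ψ i) ⊆ Φ '' {x : U | τ₀ < x.1 0 ∧ Pext x})
    (hconvR : ∀ (i : Fin N) (Rr : ℝ), Tendsto (fun τ ↦ 𝒟.toSpacetime.truncDeviationCk
      (boostedKerrBackground (mot i).1 (mot i).2 (M i) (a i)) (ψ i) 2 Rr τ) atTop (𝓝 0))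
    (Rc : Fin N → ℝ → ℝ) (hRct : ∀ i, Tendsto (Rc i) atTop atTop)
    (hRc1 : ∀ i τ, max (Kerr.rPlus (M i) (a i)) 0 + 1 ≤ Rc i τ)
    (hRc : ∀ i, Tendsto (fun τ ↦ 𝒟.toSpacetime.truncDeviationCk
      (boostedKerrBackground (mot i).1 (mot i).2 (M i) (a i)) (ψ i) 2 (Rc i τ) τ) atTop (𝓝 0))
    (hdisj : ∀ Rr : ℝ, ∃ τ₁ : ℝ, Pairwise (Function.onFun Disjoint fun i ↦
      ψ i '' (boostedKerrBackground (mot i).1 (mot i).2 (M i) (a i)).truncLateRegion τ₁ Rr))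
    -- orientation of the hole charts (re-typed summit clause `IsFutureOriented`, (i)–(ii))
    (hmotO : ∀ i, Summit.FinalStateConjecture.IsOrthochronous (mot i).1)
    (hholeO : ∀ (i : Fin N) (ρ : ℝ), ∀ᶠ τ in atTop,
      ∀ y ∈ (boostedKerrBackground (mot i).1 (mot i).2 (M i) (a i)).truncTimeSlab ρ τ,
        𝒟.timeOrientation.IsFutureDirected (mfderiv 𝓘(ℝ, E4) (𝓡 4) (ψ i) y
          (((mot i).1 : E4 ≃L[ℝ] E4) (Kerr.timeVector (M i) (a i) (poincareInv (mot i).1 (mot i).2 (y : E4))))))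
    -- the flat chart
    (U₀ : Opens E4) (hU₀ : U₀ ≤ U) (ρexc : Fin N → ℝ → ℝ)
    (hexc : ∀ i, Tendsto (fun t ↦ ρexc i t / t) atTop (𝓝 0))
    (htube : {x : E4 | τ₀' < x 0 ∧ ∀ i, ρexc i (x 0) <
      Kerr.radius (a i) (poincareInv (mot i).1 (mot i).2 x)} ⊆ (U₀ : Set E4))
    (hflatdev : Tendsto (fun t ↦ 𝒟.toSpacetime.deviationCk (Minkowski.backgroundOn U₀)
      (Φ ∘ Opens.inclusion hU₀) 2 t) atTop (𝓝 0))
    (hflatemb : IsOpenEmbedding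
      (((Minkowski.backgroundOn U₀).lateRegion τ₀').restrict (Φ ∘ Opens.inclusion hU₀)))
    (hU₀E : ∀ x : U₀, τ₀' < x.1 0 → Pext (Opens.inclusion hU₀ x))
    -- orientation of the flat chart (re-typed summit clause `IsFutureOriented`, (iii))
    (hflatO : ∀ᶠ τ in atTop, ∀ x ∈ (Minkowski.backgroundOn U₀).timeSlab τ,
      𝒟.timeOrientation.IsFutureDirected
        (mfderiv 𝓘(ℝ, E4) (𝓡 4) (Φ ∘ Opens.inclusion hU₀) x (E4.basisVector 0)))
    -- the transfer (files `…RechartTransfer*`)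
    (htransfer : ∀ τ₁ : ℝ, τ₀' ≤ τ₁ →
      O ⊆ ((Φ ∘ Opens.inclusion hU₀) '' {x : U₀ | τ₁ < x.1 0} ∪
          ⋃ i, ψ i '' {y | τ₁ < (boostedKerrBackground (mot i).1 (mot i).2 (M i) (a i)).time y.1 ∧
            (boostedKerrBackground (mot i).1 (mot i).2 (M i) (a i)).radius y.1 ≤
              Rc i ((boostedKerrBackground (mot i).1 (mot i).2 (M i) (a i)).time y.1)}) ∪
        𝒟.metric.causalPast 𝒟.timeOrientation
          ((Φ ∘ Opens.inclusion hU₀) '' {x : U₀ | x.1 0 = τ₁} ∪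
            ⋃ i, ψ i '' (boostedKerrBackground (mot i).1 (mot i).2 (M i) (a i)).truncTimeSlab
              (Rc i τ₁) τ₁)) :
    ∃ (O' : Set 𝒟.carrier) (d : FinalStateDecomposition 𝒟.toSpacetime O' 2),
      (∀ i, Kerr.IsSubextremal (d.mass i) (d.spin i)) ∧
        O' = Summit.FinalStateConjecture.exteriorOf 𝒟.toCauchyDevelopment d.charted ∧
          Summit.FinalStateConjecture.HasExhaustiveCharts d ∧ Summit.FinalStateConjecture.IsFutureOriented d := by
  -- notation
  set Kb : Fin N → ModelBackground := fun i ↦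
    boostedKerrBackground (mot i).1 (mot i).2 (M i) (a i) with hKb
  set E : Set U := {x : U | τ₀ < x.1 0 ∧ Pext x} with hE
  set C' : Set 𝒟.carrier := (Φ ∘ Opens.inclusion hU₀) '' (Minkowski.backgroundOn U₀).lateRegion τ₀' ∪
    ⋃ i, ψ i '' (Kb i).lateRegion τ₀' with hC'
  set O' : Set 𝒟.carrier := Summit.FinalStateConjecture.exteriorOf 𝒟.toCauchyDevelopment C'
    with hO'
  have hM : ∀ i, 0 < M i := fun i ↦ (abs_nonneg (a i)).trans_lt (hsub i)
  -- `C' ⊆ Φ(E)`, hence `O' ⊆ O`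
  have hC'E : C' ⊆ Φ '' E := by
    rintro p (⟨x, hx, rfl⟩ | hp)
    · exact ⟨Opens.inclusion hU₀ x, ⟨hτ.trans hx, hU₀E x hx⟩, rfl⟩
    · obtain ⟨i, y, -, rfl⟩ := mem_iUnion.mp hp
      exact hψE i (mem_range_self y)
  have hO'O : O' ⊆ O := by
    rw [hO]
    exact inter_subset_inter_right _ (LorentzianMetric.chronologicalFuture_mono hC'E)
  have hOJ : O ⊆ 𝒟.metric.causalFuture 𝒟.timeOrientation (range 𝒟.embed) := by
    rw [hO]; exact inter_subset_left
  -- `C'` is open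
  have hlateo : ∀ (i) (τ : ℝ), IsOpen ((Kb i).lateRegion τ) := fun i τ ↦
    isOpen_lt continuous_const (((PiLp.continuous_apply 2 _ 0).comp
      (continuous_poincareInv (mot i).1 (mot i).2)).comp continuous_subtype_val)
  have hC'o : IsOpen C' := by
    refine IsOpen.union ?_ (isOpen_iUnion fun i ↦ (hψemb i).isOpenMap _ (hlateo i τ₀'))
    rw [← range_restrict]
    exact hflatemb.isOpen_range
  -- every part of `C'` lies in `O'`
  have hpartO' : ∀ S : Set 𝒟.carrier, S ⊆ C' → S ⊆ O' := fun S hS ↦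
    subset_inter (hS.trans (hC'E.trans (himO.trans hOJ)))
      (subset_chronologicalPast_of_subset_isOpen hC'o hS)
  have hholeO' : ∀ i, ψ i '' (Kb i).lateRegion τ₀' ⊆ O' := fun i ↦
    hpartO' _ ((subset_iUnion (fun i ↦ ψ i '' (Kb i).lateRegion τ₀') i).trans subset_union_right)
  have hflatO' : (Φ ∘ Opens.inclusion hU₀) '' (Minkowski.backgroundOn U₀).lateRegion τ₀' ⊆ O' :=
    hpartO' _ subset_union_left
  -- the decomposition
  let d : FinalStateDecomposition 𝒟.toSpacetime O' 2 :=
    { N := N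
      mass := M
      spin := a
      mass_pos := hM
      abs_spin_le_mass := fun i ↦ (hsub i).le
      motion := mot
      τ₀ := τ₀'
      chart := fun i ↦ ψ i
      isLateChart := fun i ↦ ⟨hψs i,
        (hψemb i).comp (hlateo i τ₀').isOpenEmbedding_subtypeVal, hholeO' i⟩
      tendsto_truncDeviationCk := fun i Rr ↦ hconvR i Rr
      exists_pairwise_disjoint := hdisj
      excision := ρexc
      tendsto_excision_div := hexc
      flatDomain := U₀
      setOf_lt_excision_subset_flatDomain := htube
      flatChart := Φ ∘ Opens.inclusion hU₀
      isLateChart_flat := ⟨hΦ.comp (contMDiff_inclusion hU₀), hflatemb, hflatO'⟩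
      tendsto_deviationCk_flat := hflatdev
      diff_subset_causalPast := by
        intro p hp
        rcases htransfer τ₀' le_rfl (hO'O hp.1) with hl | hJ
        · -- certified-late points are charted-late
          exfalso
          refine hp.2 ?_
          rcases hl with ⟨x, hx, rfl⟩ | hl
          · exact Or.inr ⟨x, hx, rfl⟩
          · obtain ⟨i, y, ⟨hy1, -⟩, rfl⟩ := mem_iUnion.mp hl
            exact Or.inl (mem_iUnion.mpr ⟨i, y, hy1, rfl⟩)
        · refine LorentzianMetric.causalFuture_mono ?_ hJ
          rintro q (⟨x, hx, rfl⟩ | hq)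
          · exact Or.inr ⟨x, hx, rfl⟩
          · obtain ⟨i, y, hy, rfl⟩ := mem_iUnion.mp hq
            exact Or.inl (mem_iUnion.mpr ⟨i, y, hy.1, rfl⟩) }
  refine ⟨O', d, fun i ↦ hsub i, ?_, ⟨Rc, fun i ↦ ⟨hRct i, fun τ ↦ hRc1 i τ⟩, hRc, fun τ₁ hτ₁ ↦ ?_⟩,
    ⟨hmotO, fun i ρ ↦ hholeO i ρ, hflatO⟩⟩
  · -- `O' = J⁺(ι X) ∩ I⁻(d.charted)`: `d.charted = C'`
    have hch : d.charted = C' := by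
      show (Φ ∘ Opens.inclusion hU₀) '' (Minkowski.backgroundOn U₀).lateRegion τ₀' ∪
        ⋃ i, ψ i '' (Kb i).lateRegion τ₀' = C'
      rfl
    rw [hch]
  · -- exhaustion at chart time `τ₁ > τ₀'`
    intro p hp
    have hτ₁' : τ₀' ≤ τ₁ := le_of_lt hτ₁
    rcases htransfer τ₁ hτ₁' (hO'O hp.1) with hl | hJ
    · exact absurd hl hp.2
    · exact hJ

/-! ### Old-style radii: the honest growing radii are manufactured -/

/-- The truncated deviation at the larger of two radii is at most the sum of the two. [folklore] -/
theorem truncDeviationCk_max_le (𝓢 : Spacetime 4) (B : ModelBackground) (χ : B.domain → 𝓢.carrier)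
    (k : ℕ) (R₁ R₂ τ : ℝ) :
    𝓢.truncDeviationCk B χ k (max R₁ R₂) τ ≤ 𝓢.truncDeviationCk B χ k R₁ τ + 𝓢.truncDeviationCk B χ k R₂ τ := by
  rcases le_total R₁ R₂ with h | h
  · rw [max_eq_right h]; exact le_add_self
  · rw [max_eq_left h]; exact le_self_add

/-- Convergence along two radius profiles gives convergence along their `max`. [folklore] -/
theorem tendsto_truncDeviationCk_max (𝓢 : Spacetime 4) (B : ModelBackground) (χ : B.domain → 𝓢.carrier)
    (k : ℕ) {R₁ R₂ : ℝ → ℝ} (h₁ : Tendsto (fun τ ↦ 𝓢.truncDeviationCk B χ k (R₁ τ) τ) atTop (𝓝 0))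
    (h₂ : Tendsto (fun τ ↦ 𝓢.truncDeviationCk B χ k (R₂ τ) τ) atTop (𝓝 0)) :
    Tendsto (fun τ ↦ 𝓢.truncDeviationCk B χ k (max (R₁ τ) (R₂ τ)) τ) atTop (𝓝 0) :=
  tendsto_of_tendsto_of_tendsto_of_le_of_le tendsto_const_nhds (by simpa using h₁.add h₂)
    (fun _ ↦ zero_le) fun τ ↦ truncDeviationCk_max_le 𝓢 B χ k (R₁ τ) (R₂ τ) τ

/-- Registered one-line form (carrier `truncDeviationCk_max_le_rechart11` of the crux item) of
`truncDeviationCk_max_le`. [folklore] -/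
theorem truncDeviationCk_max_le_rechart11 : open Literature.Geometry.Lorentzian in ∀ (𝓢 : Spacetime 4) (B : ModelBackground) (χ : B.domain → 𝓢.carrier) (k : ℕ) (R₁ R₂ τ : ℝ), 𝓢.truncDeviationCk B χ k (max R₁ R₂) τ ≤ 𝓢.truncDeviationCk B χ k R₁ τ + 𝓢.truncDeviationCk B χ k R₂ τ :=
  fun 𝓢 B χ k R₁ R₂ τ ↦ truncDeviationCk_max_le 𝓢 B χ k R₁ R₂ τ

-- long bookkeeping proof
set_option maxHeartbeats 800000 in
/-- **Assembly with the re-typed summit clauses, old-style radii.** As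
`exists_finalStateDecomposition_oriented_of_rechart`, with near-zone convergence along radii `Rcᵢ` and
the transfer for `Rcᵢ` only (no growth, no honest lower bound); see the module docstring. [folklore] -/
theorem exists_finalStateDecomposition_oriented_of_rechart' (𝒟 : VacuumCauchyDevelopment D) {N : ℕ}
    (M a : Fin N → ℝ) (hsub : ∀ i, Kerr.IsSubextremal (M i) (a i))
    (mot : Fin N → lorentzGroup × E4)
    (U : Opens E4) (Φ : U → 𝒟.carrier) (hΦ : ContMDiff 𝓘(ℝ, E4) (𝓡 4) ∞ Φ)
    (O : Set 𝒟.carrier) (Pext : U → Prop) {τ₀ τ₀' : ℝ} (hτ : τ₀ < τ₀')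
    (hO : O = 𝒟.metric.causalFuture 𝒟.timeOrientation (range 𝒟.embed) ∩
      𝒟.metric.chronologicalPast 𝒟.timeOrientation (Φ '' {x : U | τ₀ < x.1 0 ∧ Pext x}))
    (himO : Φ '' {x : U | τ₀ < x.1 0 ∧ Pext x} ⊆ O)
    -- the hole charts
    (ψ : ∀ i, (boostedKerrBackground (mot i).1 (mot i).2 (M i) (a i)).domain → 𝒟.carrier)
    (hψs : ∀ i, ContMDiff 𝓘(ℝ, E4) (𝓡 4) ∞ (ψ i))
    (hψemb : ∀ i, IsOpenEmbedding (ψ i))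
    (hψE : ∀ i, range (ψ i) ⊆ Φ '' {x : U | τ₀ < x.1 0 ∧ Pext x})
    (hconvR : ∀ (i : Fin N) (Rr : ℝ), Tendsto (fun τ ↦ 𝒟.toSpacetime.truncDeviationCk
      (boostedKerrBackground (mot i).1 (mot i).2 (M i) (a i)) (ψ i) 2 Rr τ) atTop (𝓝 0))
    (Rc : Fin N → ℝ → ℝ)
    (hRc : ∀ i, Tendsto (fun τ ↦ 𝒟.toSpacetime.truncDeviationCk
      (boostedKerrBackground (mot i).1 (mot i).2 (M i) (a i)) (ψ i) 2 (Rc i τ) τ) atTop (𝓝 0))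
    (hdisj : ∀ Rr : ℝ, ∃ τ₁ : ℝ, Pairwise (Function.onFun Disjoint fun i ↦
      ψ i '' (boostedKerrBackground (mot i).1 (mot i).2 (M i) (a i)).truncLateRegion τ₁ Rr))
    -- orientation of the hole charts (re-typed summit clause `IsFutureOriented`, (i)–(ii))
    (hmotO : ∀ i, Summit.FinalStateConjecture.IsOrthochronous (mot i).1)
    (hholeO : ∀ (i : Fin N) (ρ : ℝ), ∀ᶠ τ in atTop,
      ∀ y ∈ (boostedKerrBackground (mot i).1 (mot i).2 (M i) (a i)).truncTimeSlab ρ τ,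
        𝒟.timeOrientation.IsFutureDirected (mfderiv 𝓘(ℝ, E4) (𝓡 4) (ψ i) y
          (((mot i).1 : E4 ≃L[ℝ] E4) (Kerr.timeVector (M i) (a i) (poincareInv (mot i).1 (mot i).2 (y : E4))))))
    -- the flat chart
    (U₀ : Opens E4) (hU₀ : U₀ ≤ U) (ρexc : Fin N → ℝ → ℝ)
    (hexc : ∀ i, Tendsto (fun t ↦ ρexc i t / t) atTop (𝓝 0))
    (htube : {x : E4 | τ₀' < x 0 ∧ ∀ i, ρexc i (x 0) <
      Kerr.radius (a i) (poincareInv (mot i).1 (mot i).2 x)} ⊆ (U₀ : Set E4))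
    (hflatdev : Tendsto (fun t ↦ 𝒟.toSpacetime.deviationCk (Minkowski.backgroundOn U₀)
      (Φ ∘ Opens.inclusion hU₀) 2 t) atTop (𝓝 0))
    (hflatemb : IsOpenEmbedding
      (((Minkowski.backgroundOn U₀).lateRegion τ₀').restrict (Φ ∘ Opens.inclusion hU₀)))
    (hU₀E : ∀ x : U₀, τ₀' < x.1 0 → Pext (Opens.inclusion hU₀ x))
    -- orientation of the flat chart (re-typed summit clause `IsFutureOriented`, (iii))
    (hflatO : ∀ᶠ τ in atTop, ∀ x ∈ (Minkowski.backgroundOn U₀).timeSlab τ,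
      𝒟.timeOrientation.IsFutureDirected
        (mfderiv 𝓘(ℝ, E4) (𝓡 4) (Φ ∘ Opens.inclusion hU₀) x (E4.basisVector 0)))
    -- the transfer (files `…RechartTransfer*`)
    (htransfer : ∀ τ₁ : ℝ, τ₀' ≤ τ₁ →
      O ⊆ ((Φ ∘ Opens.inclusion hU₀) '' {x : U₀ | τ₁ < x.1 0} ∪
          ⋃ i, ψ i '' {y | τ₁ < (boostedKerrBackground (mot i).1 (mot i).2 (M i) (a i)).time y.1 ∧
            (boostedKerrBackground (mot i).1 (mot i).2 (M i) (a i)).radius y.1 ≤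
              Rc i ((boostedKerrBackground (mot i).1 (mot i).2 (M i) (a i)).time y.1)}) ∪
        𝒟.metric.causalPast 𝒟.timeOrientation
          ((Φ ∘ Opens.inclusion hU₀) '' {x : U₀ | x.1 0 = τ₁} ∪
            ⋃ i, ψ i '' (boostedKerrBackground (mot i).1 (mot i).2 (M i) (a i)).truncTimeSlab
              (Rc i τ₁) τ₁)) :
    ∃ (O' : Set 𝒟.carrier) (d : FinalStateDecomposition 𝒟.toSpacetime O' 2),
      (∀ i, Kerr.IsSubextremal (d.mass i) (d.spin i)) ∧
        O' = Summit.FinalStateConjecture.exteriorOf 𝒟.toCauchyDevelopment d.charted ∧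
          Summit.FinalStateConjecture.HasExhaustiveCharts d ∧ Summit.FinalStateConjecture.IsFutureOriented d := by
  set Kb : Fin N → ModelBackground := fun i ↦
    boostedKerrBackground (mot i).1 (mot i).2 (M i) (a i) with hKb
  -- diagonal radii of the fixed-radius convergence
  have hg : ∀ i, ∃ Rg : ℝ → ℝ, Tendsto Rg atTop atTop ∧
      Tendsto (fun τ ↦ 𝒟.toSpacetime.truncDeviationCk (Kb i) (ψ i) 2 (Rg τ) τ) atTop (𝓝 0) := fun i ↦ by
    obtain ⟨Rg, -, hRt, hRc'⟩ := exists_growing_radius'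
      (f := fun τ r ↦ 𝒟.toSpacetime.truncDeviationCk (Kb i) (ψ i) 2 r τ) fun n ↦ hconvR i n
    exact ⟨Rg, hRt, hRc'⟩
  choose Rg hRgt hRgc using hg
  -- the honest growing radii
  set R : Fin N → ℝ → ℝ := fun i τ ↦ max (max (Rc i τ) (Rg i τ)) (Kerr.rPlus (M i) (a i) + 1) with hR
  have hRcR : ∀ i τ, Rc i τ ≤ R i τ := fun i τ ↦ (le_max_left _ _).trans (le_max_left _ _)
  have hrp : ∀ i, 0 < Kerr.rPlus (M i) (a i) := fun i ↦ by
    have h1 : 0 < M i := (abs_nonneg (a i)).trans_lt (hsub i)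
    unfold Kerr.rPlus
    linarith [Real.sqrt_nonneg (M i ^ 2 - a i ^ 2)]
  have hR1 : ∀ i τ, max (Kerr.rPlus (M i) (a i)) 0 + 1 ≤ R i τ := fun i τ ↦ by
    rw [max_eq_left (hrp i).le]
    exact le_max_right _ _
  have hRt : ∀ i, Tendsto (R i) atTop atTop := fun i ↦
    tendsto_atTop_mono (fun τ ↦ (le_max_right _ _).trans (le_max_left _ _)) (hRgt i)
  have hRconv : ∀ i, Tendsto (fun τ ↦ 𝒟.toSpacetime.truncDeviationCk (Kb i) (ψ i) 2 (R i τ) τ)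
      atTop (𝓝 0) := fun i ↦
    tendsto_truncDeviationCk_max _ _ _ 2 (tendsto_truncDeviationCk_max _ _ _ 2 (hRc i) (hRgc i))
      (hconvR i _)
  -- the transfer is monotone in the radii
  have htransfer' : ∀ τ₁ : ℝ, τ₀' ≤ τ₁ →
      O ⊆ ((Φ ∘ Opens.inclusion hU₀) '' {x : U₀ | τ₁ < x.1 0} ∪
          ⋃ i, ψ i '' {y | τ₁ < (Kb i).time y.1 ∧ (Kb i).radius y.1 ≤ R i ((Kb i).time y.1)}) ∪
        𝒟.metric.causalPast 𝒟.timeOrientation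
          ((Φ ∘ Opens.inclusion hU₀) '' {x : U₀ | x.1 0 = τ₁} ∪
            ⋃ i, ψ i '' (Kb i).truncTimeSlab (R i τ₁) τ₁) := by
    intro τ₁ hτ₁ p hp
    rcases htransfer τ₁ hτ₁ hp with (hl | hl) | hJ
    · exact Or.inl (Or.inl hl)
    · obtain ⟨i, y, ⟨hy1, hy2⟩, rfl⟩ := mem_iUnion.mp hl
      exact Or.inl (Or.inr (mem_iUnion.mpr ⟨i, y, ⟨hy1, hy2.trans (hRcR i _)⟩, rfl⟩))
    · refine Or.inr (LorentzianMetric.causalFuture_mono ?_ hJ)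
      refine union_subset_union le_rfl (iUnion_mono fun i ↦ image_mono ?_)
      exact (Kb i).truncTimeSlab_mono (hRcR i τ₁) τ₁
  exact exists_finalStateDecomposition_oriented_of_rechart 𝒟 M a hsub mot U Φ hΦ O Pext hτ hO himO ψ hψs
    hψemb hψE hconvR R hRt hR1 hRconv hdisj hmotO hholeO U₀ hU₀ ρexc hexc htube hflatdev hflatemb hU₀E hflatO
    htransfer'

end Core

end Summit.FinalStateConjecture.FinalStateConjecture.Theorems

end
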